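import Summits.ABC.IUTFork.Cor312VolumesSummands
import HarnessLib

/-!
# [IUTchIII] Corollary 3.12, statement — the verbatim container ASSEMBLED PLACE BY PLACE

Record-only file (D-0012) of the abc-iut cell (Cor. 3.12 sub-crew, seat abc-iut-c312-5, gen 2; D-0067 TEAM A row
A-0); TAKES NO SIDE. `Cor312VolumesSummands` types the verbatim mono-analytic container of [IUTchIII] Rmk. 3.1.1
(ii)(iii) (kurims `paper:url-4b091feeb646` pp. 94–96: direct product regions over the direct SUMMANDS `v⃗` of
`𝓘^ℚ(^{S^±_{j+1}};𝒟^⊢_{v_ℚ})`, normalized weighted log-volumes) as ONE structure `SummandPieces L` over all places. Its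
summands are supplied by DIFFERENT constructions at different places — at `v_ℚ = p` the real prime packets
`K_{v_0} ⊗_{ℚ_p} ⋯ ⊗_{ℚ_p} K_{v_j}` of abc-iut-c312-3 (companion `Cor312VolumesPadicSummands`), at `v_ℚ ∈ 𝕍_ℚ^arc` the
radial portions of Rmk. 3.1.1 (iii) — so this file provides the PER-PLACE form `LocalPieces L v_ℚ` of the same
data (one place, all labels `j`), the per-place forms of the container-preservation and generator hypotheses
(`LocalPieces.PreservesRegions`, `LocalPieces.GeneratorsPreserve` — the (Ind1)/(Ind2) generators of c312-1's
`Thm311Sig` act place by place), the assembly `SummandPieces.ofLocal (P : ∀ v_ℚ, LocalPieces L v_ℚ)`, and the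
transfer lemmas (`preservesRegions_ofLocal`, `generatorsPreserve_ofLocal`: place-by-place generator facts give
`SummandPieces.GeneratorsPreserve`, hence — `Cor312VolumesSummands`/`…Bridge` — invariance of admissibility and
log-volume along the whole indeterminacy subgroup and c312-6's `BridgeHyps.image_adm`/`image_fin`). Pure
bookkeeping; [claim: Mochizuki2012, status: disputed] for the quoted container. Deliberately NOT here: any
concrete place (companions), any judgement.
-/

noncomputable section

open Set Function

namespace Summit.ABC

namespace IUTFork

namespace Cor312Vol

open Thm311 Literature.IUT.LogThetaLattice

variable {T : ThetaIndex}

/-- **LOCAL SUMMAND PIECES at one place `v_ℚ`**: the data of `SummandPieces L` ([IUTchIII] Rmk. 3.1.1 (ii)(iii)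
p. 95–96: summand index `Π_{α∈S^±_{j+1}} 𝕍_{v_ℚ}`, summand "measure spaces" `M_{v⃗}` with admissibility predicate and
log-measure, surjective comparison `e`, nonnegative normalized weights) restricted to the packets over `v_ℚ`, for
every label `j`. Data only; no claim. [claim: Mochizuki2012, status: disputed] -/
structure LocalPieces (L : LogShells T) (vQ : T.VQ) : Type 1 where
  /-- the summand index at label `j` -/
  E : T.Label → Type
  /-- … is finite -/
  [instFintype : ∀ j, Fintype (E j)]
  /-- the summand `M_{v⃗}` -/
  X : ∀ j, E j → Type
  /-- "compact subsets of positive measure" of `M_{v⃗}` -/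
  adm : ∀ j (e : E j), Set (X j e) → Prop
  /-- the log-measure of `M_{v⃗}` -/
  logμ : ∀ j (e : E j), Set (X j e) → ℝ
  /-- a set of positive measure is nonempty -/
  adm_nonempty : ∀ j e (R : Set (X j e)), adm j e R → R.Nonempty
  /-- the log-measure is monotone on admissible sets -/
  logμ_mono : ∀ j e (R R' : Set (X j e)), adm j e R → adm j e R' → R ⊆ R' → logμ j e R ≤ logμ j e R'
  /-- the comparison map at label `j` ([IUTchIII] Prop. 3.1 (i)) -/
  e : ∀ j, L.Packet j vQ → ∀ e : E j, X j e
  /-- … is onto -/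
  e_surjective : ∀ j, Function.Surjective (e j)
  /-- the normalized weights -/
  w : ∀ j, E j → ℝ
  /-- … nonnegative -/
  w_nonneg : ∀ j e, 0 ≤ w j e

attribute [instance] LocalPieces.instFintype

/-- **Assembly place by place**: local pieces at every `v_ℚ` ARE summand pieces. [folklore] -/
def SummandPieces.ofLocal {L : LogShells T} (P : ∀ vQ : T.VQ, LocalPieces L vQ) : SummandPieces L where
  E j vQ := (P vQ).E j
  X j vQ := (P vQ).X j
  adm j vQ := (P vQ).adm j
  logμ j vQ := (P vQ).logμ j
  adm_nonempty j vQ := (P vQ).adm_nonempty j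
  logμ_mono j vQ := (P vQ).logμ_mono j
  e j vQ := (P vQ).e j
  e_surjective j vQ := (P vQ).e_surjective j
  w j vQ := (P vQ).w j
  w_nonneg j vQ := (P vQ).w_nonneg j

namespace LocalPieces

variable {L : LogShells T} {vQ : T.VQ} (P : LocalPieces L vQ)

/-- The admissible regions of the packets over `v_ℚ` (`SummandPieces.Adm` of any assembly through `P`). [claim: Mochizuki2012, status: disputed] -/
def Adm (j : T.Label) (A : Set (L.Packet j vQ)) : Prop :=
  ∃ R : ∀ e, Set (P.X j e), P.e j '' A = Set.pi univ R ∧ ∀ e, P.adm j e (R e)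

/-- Per-place form of `SummandPieces.PreservesRegions`: a self-map `Ψ` of `Π_{v⃗} M_{v⃗}` is bijective and both `Ψ`
and `Ψ⁻¹` carry direct product regions to direct product regions of the same weighted log-volume. [folklore] -/
structure PreservesRegions (P : LocalPieces L vQ) (j : T.Label) (Ψ : (∀ e, P.X j e) → ∀ e, P.X j e) : Prop where
  /-- `Ψ` is a bijection -/
  bijective : Function.Bijective Ψ
  /-- `Ψ` maps direct product regions to direct product regions of the same weighted log-volume -/
  map_pi : ∀ R : ∀ e, Set (P.X j e), (∀ e, P.adm j e (R e)) →
    ∃ R' : ∀ e, Set (P.X j e), Ψ '' Set.pi univ R = Set.pi univ R' ∧ (∀ e, P.adm j e (R' e)) ∧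
      ∑ e, P.w j e * P.logμ j e (R' e) = ∑ e, P.w j e * P.logμ j e (R e)
  /-- so does `Ψ⁻¹` -/
  preimage_pi : ∀ R : ∀ e, Set (P.X j e), (∀ e, P.adm j e (R e)) →
    ∃ R' : ∀ e, Set (P.X j e), Ψ ⁻¹' Set.pi univ R = Set.pi univ R' ∧ (∀ e, P.adm j e (R' e)) ∧
      ∑ e, P.w j e * P.logμ j e (R' e) = ∑ e, P.w j e * P.logμ j e (R e)

/-- Per-place form of `SummandPieces.GeneratorsPreserve`: at `v_ℚ`, every capsule permutation `permute σ`, every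
factor-and-summand-wise family of strip-automorphisms resp. of `Ism`-elements (c312-1's generators of (Ind1),
(Ind2), which act place by place) is intertwined by `e` with a container-preserving map. HYPOTHESIS structure
(PROVED for the real prime packets in `Cor312VolumesPadicSummands`). [folklore] -/
@[folklore]
structure GeneratorsPreserve (P : LocalPieces L vQ) : Prop where
  /-- (Ind1), permutation part -/
  perm : ∀ (j : T.Label) (σ : Equiv.Perm (T.Caps j)),
    ∃ Ψ, P.PreservesRegions j Ψ ∧ ∀ x, P.e j (L.permute j vQ σ x) = Ψ (P.e j x)
  /-- (Ind1), strip-automorphism part -/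
  strip : ∀ (j : T.Label) (g : T.Caps j → ∀ v : T.Fibre vQ, L.carrier v.1 ≃ₗ[ℚ] L.carrier v.1),
    (∀ i v, g i v ∈ L.stripAut v.1) → ∃ Ψ, P.PreservesRegions j Ψ ∧
      ∀ x, P.e j (L.factorwise j vQ (fun i => L.summandwise vQ (g i)) x) = Ψ (P.e j x)
  /-- (Ind2) -/
  ism : ∀ (j : T.Label) (g : T.Caps j → ∀ v : T.Fibre vQ, L.carrier v.1 ≃ₗ[ℚ] L.carrier v.1),
    (∀ i v, g i v ∈ L.ism v.1) → ∃ Ψ, P.PreservesRegions j Ψ ∧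
      ∀ x, P.e j (L.factorwise j vQ (fun i => L.summandwise vQ (g i)) x) = Ψ (P.e j x)

/-- **Summandwise maps preserve the container** (per-place form of `PreservesRegions.summandwise`, the
(Ind2) shape): `Ψ = Pi.map ψ`, `Ψ(y)_{v⃗} = ψ_{v⃗}(y_{v⃗})`, with bijections `ψ_{v⃗}` preserving admissibility both
ways and the log-measure of admissible sets. [folklore] -/
theorem PreservesRegions.summandwise {j : T.Label} (ψ : ∀ e, P.X j e ≃ P.X j e)
    (hadm : ∀ e (R : Set (P.X j e)), P.adm j e (ψ e '' R) ↔ P.adm j e R)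
    (hvol : ∀ e (R : Set (P.X j e)), P.adm j e R → P.logμ j e (ψ e '' R) = P.logμ j e R) :
    P.PreservesRegions j (Pi.map fun e => ⇑(ψ e)) := by
  show P.PreservesRegions j (fun y e => ψ e (y e))
  have hsymm_adm : ∀ e (R : Set (P.X j e)), P.adm j e ((ψ e).symm '' R) ↔ P.adm j e R := by
    intro e R
    rw [← hadm e ((ψ e).symm '' R), Equiv.image_symm_image]
  refine ⟨(Equiv.piCongrRight ψ).bijective, fun R hR => ?_, fun R hR => ?_⟩
  · refine ⟨fun e => ψ e '' R e, ?_, fun e => (hadm e _).2 (hR e), ?_⟩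
    · exact Set.piMap_image_univ_pi (fun e => ⇑(ψ e)) R
    · exact Finset.sum_congr rfl fun e _ => by rw [hvol e _ (hR e)]
  · refine ⟨fun e => (ψ e).symm '' R e, ?_, fun e => (hsymm_adm e _).2 (hR e), ?_⟩
    · have : (fun (y : ∀ e, P.X j e) e => ψ e (y e)) ⁻¹' Set.pi univ R =
          (fun (y : ∀ e, P.X j e) e => (ψ e).symm (y e)) '' Set.pi univ R := by
        ext y
        simp only [Set.mem_preimage, Set.mem_univ_pi, Set.mem_image]
        constructor
        · intro hy
          exact ⟨fun e => ψ e (y e), hy, funext fun e => (ψ e).symm_apply_apply (y e)⟩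
        · rintro ⟨z, hz, rfl⟩ e
          simpa using hz e
      rw [this]
      exact Set.piMap_image_univ_pi (fun e => ⇑(ψ e).symm) R
    · refine Finset.sum_congr rfl fun e _ => ?_
      have h := hvol e ((ψ e).symm '' R e) ((hsymm_adm e _).2 (hR e))
      rw [Equiv.image_symm_image] at h
      rw [h]

end LocalPieces

namespace SummandPieces

variable {L : LogShells T} (P : ∀ vQ : T.VQ, LocalPieces L vQ)

/-- The assembled admissibility at `(j, v_ℚ)` is the local one. [folklore] -/
theorem adm_ofLocal_iff (j : T.Label) (vQ : T.VQ) (A : Set (L.Packet j vQ)) :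
    (ofLocal P).Adm j vQ A ↔ (P vQ).Adm j A := Iff.rfl

/-- Per-place container preservation IS container preservation of the assembly at that place. [folklore] -/
theorem preservesRegions_ofLocal_iff {j : T.Label} {vQ : T.VQ}
    (Ψ : (∀ e, (P vQ).X j e) → ∀ e, (P vQ).X j e) :
    (ofLocal P).PreservesRegions j vQ Ψ ↔ (P vQ).PreservesRegions j Ψ :=
  ⟨fun h => ⟨h.bijective, h.map_pi, h.preimage_pi⟩, fun h => ⟨h.bijective, h.map_pi, h.preimage_pi⟩⟩

/-- **Place-by-place generator facts give the generator hypotheses of the assembly** — whence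
(`Cor312VolumesSummands`) B's `LogvolInvariant`, invariance of admissibility and log-volume along the whole
indeterminacy subgroup, and (`Cor312VolumesSummandsBridge`) c312-6's `BridgeHyps.image_adm`/`image_fin` for
settings over a line realizing the assembly. [folklore] -/
theorem generatorsPreserve_ofLocal (hP : ∀ vQ, (P vQ).GeneratorsPreserve) : (ofLocal P).GeneratorsPreserve := by
  refine ⟨fun j vQ σ => ?_, fun j vQ g hg => ?_, fun j vQ g hg => ?_⟩
  · obtain ⟨Ψ, hΨ, h⟩ := (hP vQ).perm j σ
    exact ⟨Ψ, (preservesRegions_ofLocal_iff P Ψ).2 hΨ, h⟩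
  · obtain ⟨Ψ, hΨ, h⟩ := (hP vQ).strip j g hg
    exact ⟨Ψ, (preservesRegions_ofLocal_iff P Ψ).2 hΨ, h⟩
  · obtain ⟨Ψ, hΨ, h⟩ := (hP vQ).ism j g hg
    exact ⟨Ψ, (preservesRegions_ofLocal_iff P Ψ).2 hΨ, h⟩

/-- Along the whole indeterminacy subgroup, admissible regions of a line realizing a place-by-place assembly
with place-by-place generator facts keep admissibility and log-volume. [folklore] -/
theorem adm_and_logvol_eq_of_mem_indGroup_ofLocal {D : MRData L} (hD : (ofLocal P).Realizes D)
    (hP : ∀ vQ, (P vQ).GeneratorsPreserve) {Φ : L.PacketAut}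
    (hΦ : Φ ∈ Subgroup.closure (L.Ind1Family ∪ L.Ind2Family)) (j : T.Label) (vQ : T.VQ)
    (A : Set (L.Packet j vQ)) (hA : D.Adm j vQ A) :
    D.Adm j vQ (Φ j vQ '' A) ∧ D.logvol j vQ (Φ j vQ '' A) = D.logvol j vQ A :=
  adm_and_logvol_eq_of_mem_indGroup hD (generatorsPreserve_ofLocal P hP) hΦ j vQ A hA

end SummandPieces

end Cor312Vol

end IUTFork

end Summit.ABC

end
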